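import Literature.Analysis.OperatorTheory.PositiveKernelSpectralTrace
import Literature.Analysis.OperatorTheory.HeterogeneousCyclicPeeling
import HarnessLib

/-!
# Line `vacuum_escape` (crux `BalabanLadder.IR`, stmt-QuantumFields-19354) — physical-time currency, part 1:
# iterated transfer kernels `K⁽ʲ⁺¹⁾` (toolkit)

Helper toward the EQUIVALENCE `PhysicalTimeConductance ↔ SliceGapInUnits` of the two currencies of
`Theorems/IR/VacuumEscapeDefs.lean` (census B6 «EQUIV, priced»; ideator ym-ir-idea-8; pooled prover ym-ir-line-pool-p3): the `n`-step
slice chain of the torus is the chain of the ITERATED kernel `K⁽ⁿ⁾(x,y) = ∫ K(x,z₁)K(z₁,z₂)⋯K(z_{n−1},y)`.  Abstract setting (probability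
space `(X, μ)`, bounded measurable kernel `K`); the iterates are passed as a family `Kn : ℕ → X → X → ℝ` with its recursion
`Kn 0 = K`, `Kn (j+1) x y = ∫ K x z · Kn j z y dμ(z)` (no definitions), and we prove: joint measurability and the bound `C^{j+1}`
(`measurable_bdd_iterK`), the right recursion and symmetry (`iterK_succ_right`, `iterK_symm`), positivity (`iterK_nonneg`, `le_iterK`),
the pointwise eigen-equation of a pointwise eigenfunction (`integral_iterK_mul_eigen`), the iterated pointwise operator
`κ^[j+1] ψ = ∫ Kn j (·,y) ψ(y)` (`iterate_op_eq_integral_iterK`), and the `L²` statement `A^{j+1} φ =ᵐ ∫ Kn j (·,y) φ(y)` for an operator `A`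
with kernel `K` (`pow_opKernel`).  [folklore: Chapman–Kolmogorov / Fubini]

HONEST FRAMING: transfer-operator bookkeeping for ONE format equivalence of ONE line of an open crux of a CONDITIONAL chain; nothing here
bears on weak coupling, `BalabanLadder.IR`, or the Yang–Mills mass gap (Clay); R4 of the ladder closes only `BalabanLadder.UV`.
-/

set_option autoImplicit false

noncomputable section

open MeasureTheory Filter Set Function
open scoped ENNReal
open Literature.Analysis.OperatorTheory

namespace Summit.QuantumFields.YangMills.Cruxes.IR.VacuumEscape.IterKernel

variable {X : Type*} [MeasurableSpace X] {μ : Measure X} [IsProbabilityMeasure μ]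
  {K : X → X → ℝ} {C : ℝ} {Kn : ℕ → X → X → ℝ}

/-- **Fubini for a kernel, a second kernel and an INTEGRABLE weight**: `∫ K₀(w,y) ∫ K₁(y,z) g(z) = ∫ (∫ K₀(w,y)K₁(y,z)) g(z)` for bounded
measurable `K₀, K₁` and `g ∈ L¹`. [folklore] -/
theorem integral_kernel_mul_integral_kernel_mul_of_integrable {K₀ K₁ : X → X → ℝ} (hK₀ : Measurable (uncurry K₀))
    (hK₁ : Measurable (uncurry K₁)) {C₀ C₁ : ℝ} (hC₀ : ∀ x y, ‖K₀ x y‖ ≤ C₀) (hC₁ : ∀ x y, ‖K₁ x y‖ ≤ C₁)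
    {g : X → ℝ} (hg : Integrable g μ) (w : X) :
    ∫ y, K₀ w y * ∫ z, K₁ y z * g z ∂μ ∂μ = ∫ z, (∫ y, K₀ w y * K₁ y z ∂μ) * g z ∂μ := by
  have hint : Integrable (fun p : X × X => K₀ w p.1 * (K₁ p.1 p.2 * g p.2)) (μ.prod μ) := by
    have hm : AEStronglyMeasurable (fun p : X × X => K₀ w p.1 * K₁ p.1 p.2) (μ.prod μ) :=
      (((hK₀.comp (measurable_const.prodMk measurable_fst))).mul hK₁).aestronglyMeasurable
    have hone : Integrable (fun _ : X => (1 : ℝ)) μ := integrable_const 1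
    have hg2 : Integrable (fun p : X × X => (1 : ℝ) * g p.2) (μ.prod μ) := hone.mul_prod hg
    have h1 := hg2.bdd_mul hm (c := C₀ * C₁) (Eventually.of_forall fun p => by
      rw [norm_mul]
      exact mul_le_mul (hC₀ _ _) (hC₁ _ _) (norm_nonneg _) ((norm_nonneg _).trans (hC₀ w p.1)))
    refine h1.congr (Eventually.of_forall fun p => ?_)
    simp only [one_mul]; ring
  calc ∫ y, K₀ w y * ∫ z, K₁ y z * g z ∂μ ∂μ = ∫ y, ∫ z, K₀ w y * (K₁ y z * g z) ∂μ ∂μ := by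
        refine integral_congr_ae (Eventually.of_forall fun y => ?_)
        exact (integral_const_mul _ _).symm
    _ = ∫ z, ∫ y, K₀ w y * (K₁ y z * g z) ∂μ ∂μ := integral_integral_swap hint
    _ = ∫ z, (∫ y, K₀ w y * K₁ y z ∂μ) * g z ∂μ := by
        refine integral_congr_ae (Eventually.of_forall fun z => ?_)
        show ∫ y, K₀ w y * (K₁ y z * g z) ∂μ = (∫ y, K₀ w y * K₁ y z ∂μ) * g z
        rw [← integral_mul_const]
        refine integral_congr_ae (Eventually.of_forall fun y => ?_)
        ring

/-- **Iterated kernels are jointly measurable and bounded by `C^{j+1}`** (probability space). [folklore] -/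
theorem measurable_bdd_iterK (hK : Measurable (uncurry K)) (hC : ∀ x y, ‖K x y‖ ≤ C) (hK0 : Kn 0 = K)
    (hKs : ∀ j x y, Kn (j + 1) x y = ∫ z, K x z * Kn j z y ∂μ) :
    ∀ j : ℕ, Measurable (uncurry (Kn j)) ∧ ∀ x y, ‖Kn j x y‖ ≤ C ^ (j + 1) := by
  intro j
  induction j with
  | zero =>
    rw [hK0]
    exact ⟨hK, fun x y => by simpa using hC x y⟩
  | succ j ih =>
    have hfun : Kn (j + 1) = fun x y => ∫ z, K x z * Kn j z y ∂μ := by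
      funext x y; exact hKs j x y
    obtain ⟨hm, hb⟩ := measurable_bdd_kernel_conv (ρ := μ) hK ih.1 hC ih.2
    rw [hfun]
    refine ⟨hm, fun x y => (hb x y).trans (le_of_eq ?_)⟩
    rw [probReal_univ, mul_one]; ring

/-- **Right recursion**: `Kn (j+1) x y = ∫ Kn j x z · K z y dμ(z)` (associativity of the transfer operators). [folklore] -/
theorem iterK_succ_right (hK : Measurable (uncurry K)) (hC : ∀ x y, ‖K x y‖ ≤ C) (hK0 : Kn 0 = K)
    (hKs : ∀ j x y, Kn (j + 1) x y = ∫ z, K x z * Kn j z y ∂μ) :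
    ∀ (j : ℕ) (x y : X), Kn (j + 1) x y = ∫ z, Kn j x z * K z y ∂μ := by
  intro j
  induction j with
  | zero => intro x y; rw [hKs, hK0]
  | succ j ih =>
    intro x y
    obtain ⟨hmj, hbj⟩ := measurable_bdd_iterK (μ := μ) hK hC hK0 hKs j
    have hKy : Measurable fun z => K z y := hK.comp (measurable_id.prodMk measurable_const)
    rw [hKs]
    calc ∫ z, K x z * Kn (j + 1) z y ∂μ = ∫ z, K x z * ∫ w, Kn j z w * K w y ∂μ ∂μ := by
          refine integral_congr_ae (Eventually.of_forall fun z => ?_)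
          simp only [ih z y]
      _ = ∫ w, (∫ z, K x z * Kn j z w ∂μ) * K w y ∂μ :=
          integral_kernel_mul_integral_kernel_mul (ρ := μ) hK hmj hC hbj hKy (fun w => hC w y) x
      _ = ∫ w, Kn (j + 1) x w * K w y ∂μ := by
          refine integral_congr_ae (Eventually.of_forall fun w => ?_)
          simp only [hKs j x w]

/-- **Symmetry**: a symmetric kernel has symmetric iterates. [folklore] -/
theorem iterK_symm (hK : Measurable (uncurry K)) (hC : ∀ x y, ‖K x y‖ ≤ C) (hsymm : ∀ x y, K x y = K y x)
    (hK0 : Kn 0 = K) (hKs : ∀ j x y, Kn (j + 1) x y = ∫ z, K x z * Kn j z y ∂μ) :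
    ∀ (j : ℕ) (x y : X), Kn j x y = Kn j y x := by
  intro j
  induction j with
  | zero => intro x y; rw [hK0]; exact hsymm x y
  | succ j ih =>
    intro x y
    rw [iterK_succ_right (μ := μ) hK hC hK0 hKs j x y, hKs j y x]
    refine integral_congr_ae (Eventually.of_forall fun z => ?_)
    simp only
    rw [hsymm y z, ih z x, mul_comm]

omit [IsProbabilityMeasure μ] in
/-- **Positivity**: a nonnegative kernel has nonnegative iterates. [folklore] -/
theorem iterK_nonneg (hKnn : ∀ x y, 0 ≤ K x y) (hK0 : Kn 0 = K)
    (hKs : ∀ j x y, Kn (j + 1) x y = ∫ z, K x z * Kn j z y ∂μ) :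
    ∀ (j : ℕ) (x y : X), 0 ≤ Kn j x y := by
  intro j
  induction j with
  | zero => intro x y; rw [hK0]; exact hKnn x y
  | succ j ih =>
    intro x y
    rw [hKs]
    exact integral_nonneg fun z => mul_nonneg (hKnn x z) (ih z y)

/-- **Uniform positivity**: `K ≥ κ₀ ≥ 0` pointwise gives `Kn j ≥ κ₀^{j+1}` (probability space). [folklore] -/
theorem le_iterK (hK : Measurable (uncurry K)) (hC : ∀ x y, ‖K x y‖ ≤ C) {κ₀ : ℝ} (hκ₀ : 0 ≤ κ₀)
    (hKmin : ∀ x y, κ₀ ≤ K x y) (hK0 : Kn 0 = K)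
    (hKs : ∀ j x y, Kn (j + 1) x y = ∫ z, K x z * Kn j z y ∂μ) :
    ∀ (j : ℕ) (x y : X), κ₀ ^ (j + 1) ≤ Kn j x y := by
  have hKnn : ∀ x y, 0 ≤ K x y := fun x y => hκ₀.trans (hKmin x y)
  intro j
  induction j with
  | zero => intro x y; rw [hK0, zero_add, pow_one]; exact hKmin x y
  | succ j ih =>
    intro x y
    obtain ⟨hmj, hbj⟩ := measurable_bdd_iterK (μ := μ) hK hC hK0 hKs j
    rw [hKs]
    have hint : Integrable (fun z => K x z * Kn j z y) μ := by
      refine Integrable.of_bound ?_ (C * C ^ (j + 1)) (Eventually.of_forall fun z => ?_)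
      · exact ((hK.comp (measurable_const.prodMk measurable_id)).mul
          (hmj.comp (measurable_id.prodMk measurable_const))).aestronglyMeasurable
      · rw [norm_mul]; exact mul_le_mul (hC x z) (hbj z y) (norm_nonneg _) ((norm_nonneg _).trans (hC x z))
    calc κ₀ ^ (j + 1 + 1) = ∫ _z, κ₀ * κ₀ ^ (j + 1) ∂μ := by
          rw [integral_const, probReal_univ, one_smul, pow_succ, mul_comm]
      _ ≤ ∫ z, K x z * Kn j z y ∂μ :=
          integral_mono (integrable_const _) hint fun z =>
            mul_le_mul (hKmin x z) (ih z y) (pow_nonneg hκ₀ _) (hKnn x z)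

/-- **Iterated eigen-equation of a pointwise eigenfunction**: `∫ K(x,y)h(y) = λ₀ h(x)` for every `x` (bounded measurable `h`) gives
`∫ Kn j (x,y) h(y) dμ(y) = λ₀^{j+1} h(x)` for every `x`. [folklore] -/
theorem integral_iterK_mul_eigen (hK : Measurable (uncurry K)) (hC : ∀ x y, ‖K x y‖ ≤ C) (hK0 : Kn 0 = K)
    (hKs : ∀ j x y, Kn (j + 1) x y = ∫ z, K x z * Kn j z y ∂μ) {h : X → ℝ} (hhm : Measurable h) {B : ℝ}
    (hhB : ∀ x, ‖h x‖ ≤ B) {lam₀ : ℝ} (heig : ∀ x, ∫ y, K x y * h y ∂μ = lam₀ * h x) :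
    ∀ (j : ℕ) (x : X), ∫ y, Kn j x y * h y ∂μ = lam₀ ^ (j + 1) * h x := by
  intro j
  induction j with
  | zero => intro x; rw [hK0, zero_add, pow_one]; exact heig x
  | succ j ih =>
    intro x
    obtain ⟨hmj, hbj⟩ := measurable_bdd_iterK (μ := μ) hK hC hK0 hKs j
    calc ∫ y, Kn (j + 1) x y * h y ∂μ = ∫ y, (∫ z, K x z * Kn j z y ∂μ) * h y ∂μ := by
          refine integral_congr_ae (Eventually.of_forall fun y => ?_)
          simp only [hKs j x y]
      _ = ∫ z, K x z * ∫ y, Kn j z y * h y ∂μ ∂μ :=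
          (integral_kernel_mul_integral_kernel_mul (ρ := μ) hK hmj hC hbj hhm hhB x).symm
      _ = ∫ z, K x z * (lam₀ ^ (j + 1) * h z) ∂μ := by
          refine integral_congr_ae (Eventually.of_forall fun z => ?_)
          simp only [ih z]
      _ = lam₀ ^ (j + 1) * ∫ z, K x z * h z ∂μ := by
          rw [← integral_const_mul]
          refine integral_congr_ae (Eventually.of_forall fun z => ?_); ring
      _ = lam₀ ^ (j + 1 + 1) * h x := by rw [heig x]; ring

/-- **The iterated pointwise transfer operator is integration against the iterated kernel**: for bounded measurable `ψ`,
`(κ^[j+1] ψ)(x) = ∫ Kn j (x,y) ψ(y) dμ(y)`, `κ f = ∫ K(·,z) f(z)`. [folklore] -/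
theorem iterate_op_eq_integral_iterK (hK : Measurable (uncurry K)) (hC : ∀ x y, ‖K x y‖ ≤ C) (hK0 : Kn 0 = K)
    (hKs : ∀ j x y, Kn (j + 1) x y = ∫ z, K x z * Kn j z y ∂μ) {ψ : X → ℝ} (hψm : Measurable ψ) {Bψ : ℝ}
    (hψb : ∀ y, ‖ψ y‖ ≤ Bψ) :
    ∀ (j : ℕ) (x : X), (fun f : X → ℝ => fun w => ∫ z, K w z * f z ∂μ)^[j + 1] ψ x = ∫ y, Kn j x y * ψ y ∂μ := by
  intro j
  induction j with
  | zero => intro x; rw [hK0]; simp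
  | succ j ih =>
    intro x
    obtain ⟨hmj, hbj⟩ := measurable_bdd_iterK (μ := μ) hK hC hK0 hKs j
    rw [Function.iterate_succ_apply']
    calc ∫ z, K x z * ((fun f : X → ℝ => fun w => ∫ z, K w z * f z ∂μ)^[j + 1] ψ) z ∂μ
        = ∫ z, K x z * ∫ y, Kn j z y * ψ y ∂μ ∂μ := by
          refine integral_congr_ae (Eventually.of_forall fun z => ?_)
          simp only [ih z]
      _ = ∫ y, (∫ z, K x z * Kn j z y ∂μ) * ψ y ∂μ :=
          integral_kernel_mul_integral_kernel_mul (ρ := μ) hK hmj hC hbj hψm hψb x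
      _ = ∫ y, Kn (j + 1) x y * ψ y ∂μ := by
          refine integral_congr_ae (Eventually.of_forall fun y => ?_)
          simp only [hKs j x y]

/-- **Powers of the transfer operator have the iterated kernels**: if `A φ =ᵐ ∫ K(·,y) φ(y)` on `L²(μ)` then
`A^{j+1} φ =ᵐ ∫ Kn j (·,y) φ(y)`. [folklore] -/
theorem pow_opKernel (hK : Measurable (uncurry K)) (hC : ∀ x y, ‖K x y‖ ≤ C) (hK0 : Kn 0 = K)
    (hKs : ∀ j x y, Kn (j + 1) x y = ∫ z, K x z * Kn j z y ∂μ) {A : Lp ℝ 2 μ →L[ℝ] Lp ℝ 2 μ}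
    (hA : ∀ φ : Lp ℝ 2 μ, (A φ : X → ℝ) =ᵐ[μ] fun x => ∫ y, K x y * φ y ∂μ) :
    ∀ (j : ℕ) (φ : Lp ℝ 2 μ), ((A ^ (j + 1)) φ : X → ℝ) =ᵐ[μ] fun x => ∫ y, Kn j x y * φ y ∂μ := by
  intro j
  induction j with
  | zero => intro φ; rw [zero_add, pow_one, hK0]; exact hA φ
  | succ j ih =>
    intro φ
    obtain ⟨hmj, hbj⟩ := measurable_bdd_iterK (μ := μ) hK hC hK0 hKs j
    have hφi : Integrable (fun y => (φ : X → ℝ) y) μ := (Lp.memLp φ).integrable one_le_two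
    have e1 : (A ^ (j + 1 + 1)) φ = A ((A ^ (j + 1)) φ) := by
      rw [pow_succ', mul_apply_eq_comp]
    rw [e1]
    filter_upwards [hA ((A ^ (j + 1)) φ)] with x hx
    rw [hx]
    calc ∫ y, K x y * ((A ^ (j + 1)) φ : X → ℝ) y ∂μ = ∫ z, K x z * ∫ y, Kn j z y * φ y ∂μ ∂μ :=
          integral_congr_ae (by filter_upwards [ih φ] with z hz; rw [hz])
      _ = ∫ y, (∫ z, K x z * Kn j z y ∂μ) * φ y ∂μ :=
          integral_kernel_mul_integral_kernel_mul_of_integrable (μ := μ) hK hmj hC hbj hφi x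
      _ = ∫ y, Kn (j + 1) x y * φ y ∂μ := by
          refine integral_congr_ae (Eventually.of_forall fun y => ?_)
          simp only [hKs j x y]

end Summit.QuantumFields.YangMills.Cruxes.IR.VacuumEscape.IterKernel

end
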